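import Summits.ABC.IUTFork.Conditional.WRowFrey73NineteenOfNotSquare
import Summits.ABC.IUTFork.Conditional.FreyLegendreAdmN3E
import Summits.ABC.IUTFork.Repair.RHQ3LTailUniformGalois
import HarnessLib

/-!
# R-W WINDOW-TABLE «W:FREY73-L19-INH-NONEMPTY» — (P6) at `l = 19` for `73 + 2¹³·7⁷·941² = 3¹⁶·103³·127` IN KERNEL (Frobenius at `5`),
# the datum type at `(λ₇₃, 19)` is INHABITED, and the INHABITED sub-class «`√(λ−1) ∈ F`, `e₇ = 570`» is NON-EMPTY

PROOF-ONLY file (D-0012; 0 definitions, 0 `Prop` facts, no instance, no notation) of the abc-iut cell — D-0079 RESCUE sub-cell R-W «WINDOW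
Θ-SIDE INEQUALITY», row «W:FREY73-L19-INH-NONEMPTY» = the INHABITED half of abc-iut-plan ruling C-R89 (a)(iii) «non-emptiness / admissibility
of either `l = 19` sub-class — NOT claimed anywhere», seat abc-iut-L6-t15 (gen 14). TAKES NO SIDE on [IUTchIII] Cor. 3.12 (S. Mochizuki,
*Inter-universal Teichmüller theory III*, Cor. 3.12 p. 173–174) or on any author: classical arithmetic of `ℚ` and of one elliptic curve over
`ℚ`, plus ONE application of the route's `ThetaPartII.stub_thetaData` / abc-iut-L5-t7's `F‡`-datum construction.

CONTEXT. At the `73`-triple the R-W WINDOW-TABLE tabulates (and abc-iut-w6-d102's `FreyP6T73.condP6_tabulated` certifies) the Szpiro-bad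
levels `l ∈ {73, 127}` only; `l = 19` — where abc-iut-W-row-1's TYPE-SPLIT lives (p494541 / p495544; this seat's `WRowFrey73NineteenOfNotSquare`,
p501164: `e₇ = 570 ⟺ √(λ−1) ∈ F`) — had NO (P6) certificate and NO inhabitation theorem, so both halves were «∀ T» statements over a type not
known to be non-empty. THIS FILE:

* §1 **`FreyP6T73.condP6_nineteen`** — (P6) at `(ratPoint (73/5973865915867209), 19)` IN KERNEL: w6-d102's `FreyP6Engine.condP6_ratPoint_of_certificate_nat`
  with the SAME multiplicative datum (`q = 7`, `ord_7 Δ(E₁) = 14`, `FreyP6T73.not_dvd_c₄_7` / `Δ_eq_7` / `not_dvd_D_7`) and a NEW Frobenius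
  certificate at the good prime `5`: `E₁ mod 5 = [0, 2, 0, 2, 0]`, `#Ẽ₁(𝔽₅) = 8`, `a₅ = −2`, and `X² + 2X + 5` has no root mod `19`
  (discriminant `−16 ≡ 3`, a non-residue mod `19`; one kernel `decide` over `t < 19`).
* §2 **`FreyP6T73.nonempty_thetaVolumeDatumAt_nineteen`** — `Nonempty (Cor22.ThetaVolumeDatumAt (ratPoint λ₇₃) 19)`: w6-d102's
  `FreyAdm.nonempty_thetaVolumeDatumAt_triple_list` (`UP`, `AdmitsCore`, (P2), (P5) decided from `(abc)² = ∏ p^{e_p}`, `Il = [2,3,7,73,103,127,941]`,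
  `e = [26,32,14,2,6,2,4]`; at `l = 19`: `19 ∤ e_p`, `19 ∤ e₂ − 8 = 18`) fed with §1.
* §3 **`UniformWitnessSq.exists_thetaVolumeDatumAt_isSquare_and_isSquare_sub_one`** — for ANY admissible rational point (`UP`, `AdmitsCore`, (P2),
  (P5), (P6), prime `l ≥ 5`): `∃ T : ThetaVolumeDatumAt (ratPoint q) l` with `IsSquare (algebraMap _ T.F q)` AND `IsSquare (algebraMap _ T.F (q − 1))`
  — the datum OF RECORD of abc-iut-L5-t7 / abc-iut-rh2-q3-typ-1's `UniformWitness.exists_thetaVolumeDatumAt_isGalois` (`F := F‡(λ) = thetaClosureField`,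
  `E := E_λ ⊗ F‡`, `K := F‡(E[l])`), construction copied verbatim with the conclusion read off `Cor22.exists_sq_eq_lambda[_sub_one]_thetaClosureField`.
* §4 at `(λ₇₃, 19)`: **`WRow.exists_thetaVolumeDatumAt_frey73_nineteen_isSquare`** (`∃ T, √(λ−1) ∈ T.F`) and
  **`WRow.exists_thetaVolumeDatumAt_frey73_nineteen_localType30`** (`∃ T, ∀ x₀ ∣ 7, e(K_{x₀}/ℚ_7) = 570`, ∘ abc-iut-W-neg-2's
  `GenuineK.absRamificationIdx_kOf_eq_thirty_mul_of_isSquare` through p501164's iff) ⇒ the INHABITED sub-class of the `l = 19` TYPE-SPLIT is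
  NON-EMPTY, i.e. abc-iut-W-row-1's `WRow.licence_frey73_nineteen_of_localType30` / `…_of_isSquare` (p495544) quantify over a non-empty class.
NOT claimed: non-emptiness of the REFUTED sub-class («`√(λ−1) ∉ F`, `e₇ = 285`») — it needs a genuine-datum constructor over a sub-Θ field NOT
containing `√(λ−1)` (e.g. print's `F_E = ℚ(√−1, E_λ[15])`, `IsThetaField`), and the tree's only constructor is the `F‡` one
(`Cor22.thetaDataExistsAt_of_condP6_thetaClosure`); nothing here about which admissible `F` print intends. HONEST SCOPE: «inhabited» = OUR typed
datum type has an element in the named sub-class; (P6) = a kernel Frobenius certificate for OUR integral model `E₁`; «inhabited as typed» ≠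
«asserted in print»; typed ≠ proved; instantiated ≠ endorsed; no abc claim.
[cite: Mochizuki2012, IUTchI Def. 3.1 (b),(c) pp. 61–62; IUTchIV Thm. 1.10 p. 22, Cor. 2.2 (ii) proof (P2)(P5)(P6)(P7) pp. 43–46] [cite: SilvermanAEC2009, V.2 (Hasse), VIII.§1, VII.5 Prop. 5.1(b)]
[cite: SerreInventiones1972, §2.8 Prop. 19] [claim: Mochizuki2012, status: disputed] for every IUT quotation.
-/

noncomputable section

open scoped Classical

open Set Function NumberField IsDedekindDomain

namespace Summit.ABC.IUTFork.Conditional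

open Literature.IUT.LogThetaLattice Literature.IUT.LogVolume Literature.IUT.HodgeTheaters
open Literature.IUT.LogVolume.ThetaData Literature.IUT.LogVolume.Cor22
open Summit.ABC.IUTFork.Thm311 Summit.ABC.IUTFork.Thm311.Real Summit.ABC.IUTFork.Cor312Prov
open Literature.NumberTheory.NumberFields Literature.NumberTheory.DiophantineGeometry Literature.NumberTheory.DiophantineGeometry.GenEll
open Literature.NumberTheory.EllipticCurves WeierstrassCurve IntermediateField

/-! ## §1. (P6) at `l = 19` for `λ₇₃ = 73/5973865915867209`: the Frobenius certificate at `p = 5` -/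

namespace FreyP6T73

/-- `E₁ mod 5 = [0, 2, 0, 2, 0]` (`c ≡ 4`, `c² + 73c ≡ 1 + 2 = 3`, `73c³ ≡ 3·4 = 2 (mod 5)`). [folklore] -/
theorem model_map_5 :
    ((
      ⟨0, -(((5973865915867209 : ℕ) : ℤ) ^ 2 + (73 : ℕ) * (5973865915867209 : ℕ)), 0,
        ((73 : ℕ) : ℤ) * ((5973865915867209 : ℕ) : ℤ) ^ 3, 0⟩ : WeierstrassCurve ℤ)).map (Int.castRingHom (ZMod 5)) = ⟨0, 2, 0, 2, 0⟩ := by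
  ext <;> decide +kernel

/-- `a_5(E₁) = 5 + 1 − #Ẽ₁(𝔽_5) = 6 − 8 = −2` — the point count `#Ẽ₁(𝔽_5) = 8` of `y² = x³ + 2x² + 2x` is a KERNEL computation
(Euler's criterion, `card_sol_eq_sum_euler` / `natCard_point_eq_one_add_card`, as in w6-d102's `frobeniusTrace_19`). [cite: SilvermanAEC2009, V.2 Thm. 2.3.1] -/
theorem frobeniusTrace_5 : Literature.NumberTheory.Automorphic.frobeniusTrace
    (
      ⟨0, -(((5973865915867209 : ℕ) : ℤ) ^ 2 + (73 : ℕ) * (5973865915867209 : ℕ)), 0,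
        ((73 : ℕ) : ℤ) * ((5973865915867209 : ℕ) : ℤ) ^ 3, 0⟩ : WeierstrassCurve ℤ) 5 = -2 := by
  have hc : Nat.card (⟨0, 2, 0, 2, 0⟩ : WeierstrassCurve (ZMod 5)).toAffine.Point = 8 := by
    rw [@WeierstrassCurve.natCard_point_eq_one_add_card (ZMod 5) (@ZMod.instField 5 ⟨by norm_num⟩) _ _ _
      (by decide +kernel), @card_sol_eq_sum_euler (ZMod 5) (@ZMod.instField 5 ⟨by norm_num⟩) _ _
      (by rw [ZMod.ringChar_zmod_n]; decide)]
    decide +kernel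
  rw [Literature.NumberTheory.Automorphic.frobeniusTrace, Literature.NumberTheory.Automorphic.numPointsMod,
    model_map_5, hc]; norm_num

/-- `5 ∤ Δ(E₁)` (`5` is a good prime: `5 ∤ 2·3·7·73·103·127·941`). [folklore] -/
theorem not_dvd_Δ_5 : ¬ ((5 : ℕ) : ℤ) ∣ ((
      ⟨0, -(((5973865915867209 : ℕ) : ℤ) ^ 2 + (73 : ℕ) * (5973865915867209 : ℕ)), 0,
        ((73 : ℕ) : ℤ) * ((5973865915867209 : ℕ) : ℤ) ^ 3, 0⟩ : WeierstrassCurve ℤ)).Δ := by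
  rw [FreyP6Engine.Δ_model]; norm_num

/-- **(P6) at `(ratPoint (73/5973865915867209), 19)` IN KERNEL** — multiplicative prime `7` (`ord_7 Δ = 14`, `19 ∤ 14`), Frobenius
certificate `p = 5` (`a₅ = −2`; `X² + 2X + 5` rootless mod `19`, ONE kernel `decide` over `t < 19`): the image of `Gal(F̄/F)` on `E_F[19]`
contains `SL₂(𝔽₁₉)` for every theta-field `F`. `l = 19` is a Szpiro-GOOD level of this triple, NOT tabulated in the R-W WINDOW-TABLE
(tabulated: `73, 127`, w6-d102's `condP6_tabulated`). [cite: Mochizuki2012, IUTchIV Cor. 2.2 (ii) (P6) p.46] [cite: SerreInventiones1972, §2.8 Prop. 19] -/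
theorem condP6_nineteen : Cor22.CondP6 (ratPoint (((73 : ℕ) : ℚ) / (5973865915867209 : ℕ))) 19 :=
  FreyP6Engine.condP6_ratPoint_of_certificate_nat (73) (5973865915867209) (by norm_num) (by norm_num) (by norm_num)
    7 (by norm_num) not_dvd_c₄_7 14 (by norm_num) _ Δ_eq_7 not_dvd_D_7 5 (by norm_num) not_dvd_Δ_5 (-2) frobeniusTrace_5
    19 (by refine ⟨by norm_num, by norm_num, by norm_num, by norm_num, by norm_num⟩) (by decide)

/-! ## §2. The datum type at `(λ₇₃, 19)` is INHABITED -/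

/-- **`Nonempty (Cor22.ThetaVolumeDatumAt (ratPoint (73/5973865915867209)) 19)`** — `UP`, `AdmitsCore`, (P2), (P5) decided from the factorisation
`(abc)² = 2²⁶·3³²·7¹⁴·73²·103⁶·127²·941⁴` exactly as in w6-d102's `nonempty_thetaVolumeDatumAt_tabulated` (same `Il`, same `e`), at the NEW
level `l = 19` (`19 ∤ e_p` for odd `p`, `19 ∤ e₂ − 8 = 18`, odd `p₀ = 3 ≠ 19`), with (P6) = `condP6_nineteen`.
[cite: Mochizuki2012, IUTchIV Cor. 2.2 (ii) proof (P2)(P5)(P6)(P7) p. 45–46] [claim: Mochizuki2012, status: disputed] -/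
theorem nonempty_thetaVolumeDatumAt_nineteen :
    Nonempty (Cor22.ThetaVolumeDatumAt (ratPoint (((73 : ℕ) : ℚ) / (5973865915867209 : ℕ))) 19) :=
  FreyAdm.nonempty_thetaVolumeDatumAt_triple_list (a := 73) (b := 2 ^ 13 * 7 ^ 7 * 941 ^ 2) (c := 5973865915867209)
    (by unfold IsABCTriple; decide +kernel)
    (Il := [2, 3, 7, 73, 103, 127, 941]) (e := fun p => if p = 2 then 26 else if p = 3 then 32 else if p = 7 then 14 else if p = 73 then 2 else if p = 103 then 6 else if p = 127 then 2 else if p = 941 then 4 else 0)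
    (by intro p hp; fin_cases hp <;> norm_num) (by decide) (by decide +kernel) (by decide +kernel)
    (by unfold Cor22.coreExceptionalJ; decide +kernel)
    [19]
    (by decide +kernel) (fun l hl => by rw [List.mem_singleton.mp hl]; exact condP6_nineteen) 19 (List.mem_singleton.mpr rfl)

end FreyP6T73

/-! ## §3. The datum of record at an admissible rational point has `√λ ∈ F` and `√(λ−1) ∈ F` -/

namespace UniformWitnessSq

/-- **The genuine Θ-volume datum of record at an admissible rational point has BOTH twist roots in its field.** For `λ = q ∈ U_P(ℚ)`, a prime
`l ≥ 5`, `AdmitsCore`, (P2), (P5), (P6): there is `T : ThetaVolumeDatumAt (ratPoint q) l` with `IsSquare (q : T.F)` and `IsSquare (q − 1 : T.F)` —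
the inhabitant of abc-iut-L5-t7 / c312-8 (`Cor22.thetaDataExistsAt_of_condP6_thetaClosure`, `ThetaPartII.stub_thetaData`) made explicit with
`F := F‡(q) = ℚ(√−1, √q, √(q−1), E_q[15])` (`Cor22.thetaClosureField`), `E := E_q ⊗ F‡`, `K := F‡(E[l])`, exactly as in abc-iut-rh2-q3-typ-1's
`UniformWitness.exists_thetaVolumeDatumAt_isGalois` (construction copied; conclusion from `Cor22.exists_sq_eq_lambda_thetaClosureField` /
`Cor22.exists_sq_eq_lambda_sub_one_thetaClosureField`). [cite: Mochizuki2012, IUTchIV Thm. 1.10 p. 22, Cor. 2.2 (ii) proof (P7) p. 46] [claim: Mochizuki2012, status: disputed] -/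
theorem exists_thetaVolumeDatumAt_isSquare_and_isSquare_sub_one {q : ℚ} (hP : ratPoint q ∈ UP) {l : ℕ} (hl : l.Prime) (h5 : 5 ≤ l)
    (hcore : AdmitsCore (ratPoint q)) (hP2 : CondP2 (ratPoint q) l) (hP5 : CondP5 (ratPoint q) l) (h6 : CondP6 (ratPoint q) l) :
    ∃ T : ThetaVolumeDatumAt (ratPoint q) l,
      (letI := T.instFieldF; letI := T.instAlgebraF; IsSquare (algebraMap (ratPoint q).F T.F q)) ∧
      (letI := T.instFieldF; letI := T.instAlgebraF; IsSquare (algebraMap (ratPoint q).F T.F ((q - 1 : ℚ)))) := by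
  -- adapted from abc-iut-rh2-q3-typ-1's `UniformWitness.exists_thetaVolumeDatumAt_isGalois` (Repair/RHQ3LTailUniformGalois.lean)
  set P := ratPoint q with hPdef
  haveI : Fact P.InU := ⟨hP.1⟩
  haveI : (thetaCurve P (thetaClosureField P)).IsElliptic := thetaCurve_isElliptic hP.1 _
  haveI : NeZero l := ⟨hl.ne_zero⟩
  haveI : IsGalois (thetaClosureField P) (AlgebraicClosure (thetaClosureField P)) := {}
  have h7 : 7 ≤ l := Cor22.seven_le_of_condP6 hP.1 hl h5 h6
  have h6cop : l.Coprime 6 := by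
    rw [show (6 : ℕ) = 2 * 3 by norm_num]
    exact Nat.Coprime.mul_right ((Nat.coprime_primes hl Nat.prime_two).2 (by omega))
      ((Nat.coprime_primes hl Nat.prime_three).2 (by omega))
  obtain ⟨geom⟩ := ThetaGeometryModel.nonempty_thetaGeometry_galois (thetaClosureField P)
    (TorsionField (thetaCurve P (thetaClosureField P)) l) (AlgebraicClosure (thetaClosureField P)) h5 h6cop
  obtain ⟨D, hD, hP5c⟩ := exists_initialThetaData_thetaClosure P hP hl h7 hcore hP2 hP5 h6 (BadPlacePredicates.trivial _) geom
    (fun w _ => (BadPlacePredicates.trivial_holds _ w).1) (fun w _ => (BadPlacePredicates.trivial_holds _ w).2)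
  obtain ⟨I, hI⟩ := ThetaData.exists_isVolumeInputOf D
  have hj : (thetaCurve P (thetaClosureField P)).j = algebraMap P.F (thetaClosureField P) (jInv P.x) := by
    have := thetaCurve_j (F := thetaClosureField P) hP.1
    convert this using 2
  obtain ⟨w, hw⟩ := exists_sq_eq_lambda_thetaClosureField P
  obtain ⟨w1, hw1⟩ := exists_sq_eq_lambda_sub_one_thetaClosureField P
  refine ⟨{ F := thetaClosureField P
            K := TorsionField (thetaCurve P (thetaClosureField P)) l
            Fbar := AlgebraicClosure (thetaClosureField P)
            E := thetaCurve P (thetaClosureField P)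
            j_eq := hj
            torsion_thirty_rational := torsion_thirty_rational_thetaClosure P hP.1
            isSubThetaField := isSubThetaField_thetaClosureField P hP.1
            Pb := BadPlacePredicates.trivial _
            D := D
            I := I
            isP5Choice := hP5c
            isVolumeInputOf := hI }, ?_, ?_⟩
  · -- `√q ∈ F‡`
    have hw' : algebraMap (ratPoint q).F (thetaClosureField P) q = w ^ 2 := hw.symm
    exact ⟨w, by rw [hw', sq]⟩
  · -- `√(q − 1) ∈ F‡`
    have hw1' : algebraMap (ratPoint q).F (thetaClosureField P) ((q - 1 : ℚ)) = w1 ^ 2 := hw1.symm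
    exact ⟨w1, by rw [hw1', sq]⟩

end UniformWitnessSq

/-! ## §4. `(λ₇₃, 19)`: the INHABITED sub-class «`√(λ−1) ∈ F`, `e₇ = 570`» is NON-EMPTY -/

/-- **`∃ T : ThetaVolumeDatumAt (ratPoint λ₇₃) 19` with `√(λ−1) ∈ T.F`** (the datum of record over `F‡(λ₇₃)`; `UP`, `AdmitsCore`, (P2), (P5) by
w6-d102's `FreyRef` / `FreyAdm` deciders from the factorisation, (P6) by §1). [cite: Mochizuki2012, IUTchIV Cor. 2.2 (ii) proof (P2)(P5)(P6)(P7) p. 45–46]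
[claim: Mochizuki2012, status: disputed] -/
theorem WRow.exists_thetaVolumeDatumAt_frey73_nineteen_isSquare :
    ∃ T : Cor22.ThetaVolumeDatumAt (ratPoint (((73 : ℕ) : ℚ) / (5973865915867209 : ℕ))) 19,
      (letI := T.instFieldF; letI := T.instAlgebraF;
        IsSquare (algebraMap (ratPoint (((73 : ℕ) : ℚ) / (5973865915867209 : ℕ))).F T.F ((((73 : ℕ) : ℚ) / (5973865915867209 : ℕ) - 1 : ℚ)))) := by
  have habc : IsABCTriple 73 (2 ^ 13 * 7 ^ 7 * 941 ^ 2) 5973865915867209 := by unfold IsABCTriple; decide +kernel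
  have hI : ∀ p ∈ ([2, 3, 7, 73, 103, 127, 941] : List ℕ), p.Prime := by intro p hp; fin_cases hp <;> norm_num
  have hnd : ([2, 3, 7, 73, 103, 127, 941] : List ℕ).Nodup := by decide
  set e : ℕ → ℕ := fun p => if p = 2 then 26 else if p = 3 then 32 else if p = 7 then 14 else if p = 73 then 2 else if p = 103 then 6
    else if p = 127 then 2 else if p = 941 then 4 else 0 with he_def
  have he : ∀ p ∈ ([2, 3, 7, 73, 103, 127, 941] : List ℕ), e p ≠ 0 := by rw [he_def]; decide +kernel
  have hD : (73 * (2 ^ 13 * 7 ^ 7 * 941 ^ 2) * 5973865915867209) ^ 2 =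
      (([2, 3, 7, 73, 103, 127, 941] : List ℕ).map fun p => p ^ e p).prod := by rw [he_def]; decide +kernel
  have hUP := FreyRef.ratPoint_triple_mem_UP habc
  have hcore : AdmitsCore (ratPoint (((73 : ℕ) : ℚ) / (5973865915867209 : ℕ))) :=
    FreyAdm.admitsCore_triple habc (by unfold Cor22.coreExceptionalJ; decide +kernel)
  have hP2 : CondP2 (ratPoint (((73 : ℕ) : ℚ) / (5973865915867209 : ℕ))) 19 :=
    FreyAdm.condP2_triple habc hI hnd he hD (by rw [he_def]; decide +kernel) (by rw [he_def]; decide +kernel)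
  have hP5 : CondP5 (ratPoint (((73 : ℕ) : ℚ) / (5973865915867209 : ℕ))) 19 :=
    FreyAdm.condP5_triple habc hI hnd he hD (p₀ := 3) (by norm_num) (by decide) (by norm_num) (by norm_num)
  obtain ⟨T, -, hT⟩ := UniformWitnessSq.exists_thetaVolumeDatumAt_isSquare_and_isSquare_sub_one hUP (by norm_num) (by norm_num)
    hcore hP2 hP5 FreyP6T73.condP6_nineteen
  exact ⟨T, hT⟩

/-- **`∃ T : ThetaVolumeDatumAt (ratPoint λ₇₃) 19` with `e(K_{x₀}/ℚ_7) = 570` at EVERY fibre point `x₀ ∣ 7`** — the INHABITED sub-class of the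
`l = 19` TYPE-SPLIT is NON-EMPTY (the `F‡`-datum ∘ this seat's `WRow.absRamificationIdx_frey73_seven_eq_thirty_mul_iff_isSquare`, p501164, whose
(⟸) is abc-iut-W-neg-2's `GenuineK.absRamificationIdx_kOf_eq_thirty_mul_of_isSquare`). Hence abc-iut-W-row-1's `WRow.licence_frey73_nineteen_of_localType30`
/ `…_of_isSquare` (p495544) quantify over a NON-EMPTY class of genuine data. The REFUTED sub-class (`e₇ = 285`, `√(λ−1) ∉ F`) is NOT shown
non-empty here. [cite: Mochizuki2012, IUTchI Def. 3.1 (b),(c) pp. 61–62; IUTchIV Thm. 1.10 p. 22 and proof Steps (ii)–(iii) p. 24–26, Cor. 2.2 (ii) proof (P5)–(P7) p. 46]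
[claim: Mochizuki2012, status: disputed] -/
theorem WRow.exists_thetaVolumeDatumAt_frey73_nineteen_localType30 :
    ∃ T : Cor22.ThetaVolumeDatumAt (ratPoint (((73 : ℕ) : ℚ) / (5973865915867209 : ℕ))) 19,
      letI := T.instFieldF; letI := T.instNumberFieldF; letI := T.instAlgebraF; letI := T.instFieldK
      letI := T.instNumberFieldK; letI := T.instAlgebraK; letI := T.instFieldFbar; letI := T.instAlgebraFbar
      letI := T.instAlgebraKFbar; letI := T.instIsElliptic
      haveI : Fact (Nat.Prime 7) := ⟨by norm_num⟩
      ∀ x₀ : (thetaIndex (pilotDataOfK T.D T.K)).Fibre (.inr ⟨7, by norm_num⟩),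
        absRamificationIdx 7 (kOf (pilotDataOfK T.D T.K) 7 x₀) = 570 := by
  obtain ⟨T, hT⟩ := WRow.exists_thetaVolumeDatumAt_frey73_nineteen_isSquare
  refine ⟨T, fun x₀ => ?_⟩
  have h := (WRow.absRamificationIdx_frey73_seven_eq_thirty_mul_iff_isSquare T (by norm_num) x₀).2 hT
  norm_num at h
  exact h

end Summit.ABC.IUTFork.Conditional

end
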